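import Summits.AtomisticToContinuum.Crystallization.Theorems.FrustratedLawDichotomyStrainedPatchHomRelief

/-!
# The INDEX-BOX ENUMERATION lemma for the lattice sums of `(H)` under `‖G − 1‖ ≤ 1/4` — fcc family
# (27623 strained-patch piece; decomp-a2c, prover hand 2, generation 20; critic row 758 instruction «include the index-box enumeration lemma»)

`…StrainedPatchHomLattice.homFloor_of_latticeSums` (p842566) reduces `HomFloor m` to lattice-sum inequalities written as `finsum`s over the
(infinite) displacement sets, e.g. `∑ᶠ v ∈ {v ≠ 0 ∧ ∃ b, v = latPt G fccVec b}, W ‖v‖`.  A certificate evaluates a FINITE sum over integer labels.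
This DEF-FREE module proves the two are equal for the fcc family (the hcp twin is the sequel):

* §1 `‖G − 1‖ ≤ 1/4 ⟹ ¾‖w‖ ≤ ‖G w‖` for EVERY vector (`norm_apply_ge_of_near_one`), hence `G` and `b ↦ latPt G fccVec b` are injective;
* §2 ★ COORDINATE BOX: `‖fccPoint b‖ < 4R/3 ∧ 8R² < 3(K+1)² ⟹ b ∈ [−K, K]³` (`mem_box_of_norm_fccPoint_lt`; from `4bᵢ² ≤ 3·((b₂+b₃)² + (b₁+b₃)² + (b₁+b₂)²)
  = 6‖fccPoint b‖² < 32R²/3`);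
* §3 ★★ ENUMERATION `latticeSum_fcc_eq_boxSum`: for `W` vanishing from `R` on and `8R² < 3(K+1)²`,
  `∑ᶠ v ∈ G·L_fcc ∖ 0, W ‖v‖ = Σ_{b ∈ [−K,K]³, b ≠ 0} W ‖latPt G fccVec b‖`; record instance `R = 9/2`, `K = 7` for `W₄₅ = effPot w₄₅ ω₄ (3/400)`
  (`latticeSum_fcc_eq_boxSum_record`: `8·(9/2)² = 162 < 192 = 3·8²`), i.e. `15³ − 1 = 3374` labels;
* §4 the fcc hypothesis of `homFloor_of_latticeSums` in box form (`homFloor_of_boxSum_fcc_of_latticeSum_hcp`).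

0 sorry; no definitions; axioms ⊆ {propext, Classical.choice, Quot.sound}.  `--supports stmt-AtomisticToContinuum-27623`.
-/

noncomputable section

namespace Summit.AtomisticToContinuum.Crystallization.Theorems.FrustratedLawDichotomyStrainedPatchHomLatticeBox

open scoped BigOperators Classical
open Summit.AtomisticToContinuum.Crystallization.Theorems.ChargedEnergyGapNegative (E3)
open Summit.AtomisticToContinuum.Crystallization.Theorems.FrustratedLawDichotomySchurCut (effPot w₄₅ ω₄ effPot_fourHalf_eq_zero)
open Summit.AtomisticToContinuum.Crystallization.Theorems.FrustratedLawDichotomyStrainedPatchHomSplit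
open Summit.AtomisticToContinuum.Crystallization.Theorems.FrustratedLawDichotomyStrainedPatchHomLattice
open Summit.AtomisticToContinuum.Crystallization.Theorems.FrustratedLawDichotomyStrainedPatchHomRelief
open Literature.Barriers.AtomisticToContinuum.FlatleyTheil2015 (fccVec fccPoint fccPoint_eq_sum norm_fccPoint_sq fccPoint_injective)

/-! ## §1. `‖G − 1‖ ≤ 1/4`: a uniform lower bound and injectivity -/

/-- ★ `‖G − 1‖ ≤ 1/4 ⟹ ¾‖w‖ ≤ ‖G w‖` for every `w`. [folklore] -/
theorem norm_apply_ge_of_near_one {G : E3 →L[ℝ] E3} (hG : ‖G - 1‖ ≤ 1 / 4) (w : E3) : 3 / 4 * ‖w‖ ≤ ‖G w‖ := by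
  have hdec : w = G w - (G - 1) w := by simp
  have htri : ‖w‖ ≤ ‖G w‖ + ‖(G - 1) w‖ := by
    calc ‖w‖ = ‖G w - (G - 1) w‖ := by rw [← hdec]
      _ ≤ ‖G w‖ + ‖(G - 1) w‖ := norm_sub_le _ _
  have hop : ‖(G - 1) w‖ ≤ 1 / 4 * ‖w‖ := ((G - 1).le_opNorm w).trans (mul_le_mul_of_nonneg_right hG (norm_nonneg _))
  linarith

/-- `‖G − 1‖ ≤ 1/4 ⟹ G` is injective. [folklore] -/
theorem injective_of_near_one {G : E3 →L[ℝ] E3} (hG : ‖G - 1‖ ≤ 1 / 4) : Function.Injective G := by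
  intro v w h
  have h0 : G (v - w) = 0 := by rw [map_sub, h, sub_self]
  have h1 := norm_apply_ge_of_near_one hG (v - w)
  rw [h0, norm_zero] at h1
  have h2 : ‖v - w‖ = 0 := le_antisymm (by linarith [norm_nonneg (v - w)]) (norm_nonneg _)
  exact sub_eq_zero.1 (norm_eq_zero.1 h2)

/-- `latPt G f 0 = 0`. [formal bookkeeping] -/
theorem latPt_zero (G : E3 →L[ℝ] E3) (f : Fin 3 → E3) : latPt G f 0 = 0 := by
  simp [latPt]

/-- `‖G − 1‖ ≤ 1/4 ⟹ b ↦ latPt G fccVec b` is injective. [folklore] -/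
theorem latPt_fcc_injective {G : E3 →L[ℝ] E3} (hG : ‖G - 1‖ ≤ 1 / 4) : Function.Injective (latPt G fccVec) := fun a b h => by
  rw [latPt_fccVec_eq, latPt_fccVec_eq] at h
  exact fccPoint_injective (injective_of_near_one hG h)

/-! ## §2. The coordinate box -/

/-- ★ **COORDINATE BOX**: `‖fccPoint b‖ < 4R/3` and `8R² < 3(K+1)²` put every coordinate of `b` in `[−K, K]`
(`4bᵢ² ≤ 3·((b₂+b₃)² + (b₁+b₃)² + (b₁+b₂)²) = 6‖fccPoint b‖² < 32R²/3`). [folklore] -/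
theorem mem_box_of_norm_fccPoint_lt {b : Fin 3 → ℤ} {R : ℝ} {K : ℕ} (hK : 8 * R ^ 2 < 3 * ((K : ℝ) + 1) ^ 2)
    (hb : ‖fccPoint b‖ < 4 / 3 * R) : b ∈ Fintype.piFinset fun _ : Fin 3 => Finset.Icc (-(K : ℤ)) K := by
  have hn := norm_nonneg (fccPoint b)
  have hsq : ‖fccPoint b‖ ^ 2 < (4 / 3 * R) ^ 2 := by nlinarith
  rw [norm_fccPoint_sq] at hsq
  have hS : ((((b 1 + b 2) ^ 2 + (b 0 + b 2) ^ 2 + (b 0 + b 1) ^ 2 : ℤ)) : ℝ) < 32 / 9 * R ^ 2 := by nlinarith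
  -- integer inequalities `4 bᵢ² ≤ 3 S`
  have h0 : 4 * (b 0) ^ 2 ≤ 3 * ((b 1 + b 2) ^ 2 + (b 0 + b 2) ^ 2 + (b 0 + b 1) ^ 2) := by
    nlinarith [sq_nonneg (b 1 - b 2), sq_nonneg (b 0 + 2 * b 1 + b 2), sq_nonneg (b 0 + b 1 + 2 * b 2)]
  have h1 : 4 * (b 1) ^ 2 ≤ 3 * ((b 1 + b 2) ^ 2 + (b 0 + b 2) ^ 2 + (b 0 + b 1) ^ 2) := by
    nlinarith [sq_nonneg (b 0 - b 2), sq_nonneg (b 1 + 2 * b 0 + b 2), sq_nonneg (b 1 + b 0 + 2 * b 2)]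
  have h2 : 4 * (b 2) ^ 2 ≤ 3 * ((b 1 + b 2) ^ 2 + (b 0 + b 2) ^ 2 + (b 0 + b 1) ^ 2) := by
    nlinarith [sq_nonneg (b 1 - b 0), sq_nonneg (b 2 + 2 * b 1 + b 0), sq_nonneg (b 2 + b 1 + 2 * b 0)]
  have h0' : (4 : ℝ) * ((b 0 : ℤ) : ℝ) ^ 2 ≤ 3 * ((((b 1 + b 2) ^ 2 + (b 0 + b 2) ^ 2 + (b 0 + b 1) ^ 2 : ℤ)) : ℝ) := by
    exact_mod_cast h0
  have h1' : (4 : ℝ) * ((b 1 : ℤ) : ℝ) ^ 2 ≤ 3 * ((((b 1 + b 2) ^ 2 + (b 0 + b 2) ^ 2 + (b 0 + b 1) ^ 2 : ℤ)) : ℝ) := by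
    exact_mod_cast h1
  have h2' : (4 : ℝ) * ((b 2 : ℤ) : ℝ) ^ 2 ≤ 3 * ((((b 1 + b 2) ^ 2 + (b 0 + b 2) ^ 2 + (b 0 + b 1) ^ 2 : ℤ)) : ℝ) := by
    exact_mod_cast h2
  have hK0 : (0 : ℝ) ≤ (K : ℝ) + 1 := by positivity
  have hb0 : ((b 0 : ℤ) : ℝ) ^ 2 < ((K : ℝ) + 1) ^ 2 := by nlinarith
  have hb1 : ((b 1 : ℤ) : ℝ) ^ 2 < ((K : ℝ) + 1) ^ 2 := by nlinarith
  have hb2 : ((b 2 : ℤ) : ℝ) ^ 2 < ((K : ℝ) + 1) ^ 2 := by nlinarith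
  have hc : ∀ i : Fin 3, ((b i : ℤ) : ℝ) ^ 2 < ((K : ℝ) + 1) ^ 2 → b i ∈ Finset.Icc (-(K : ℤ)) K := by
    intro i hi
    obtain ⟨hlo, hhi⟩ := abs_lt_of_sq_lt_sq' hi hK0
    have hlo' : -((K : ℤ) + 1) < b i := by exact_mod_cast (by push_cast; linarith : (((-((K : ℤ) + 1) : ℤ)) : ℝ) < b i)
    have hhi' : b i < (K : ℤ) + 1 := by exact_mod_cast (by push_cast; linarith : ((b i : ℤ) : ℝ) < (((K : ℤ) + 1 : ℤ) : ℝ))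
    exact Finset.mem_Icc.2 ⟨by omega, by omega⟩
  exact Fintype.mem_piFinset.2 fun i => by
    fin_cases i
    · exact hc 0 hb0
    · exact hc 1 hb1
    · exact hc 2 hb2

/-! ## §3. The enumeration lemma -/

/-- ★★ **INDEX-BOX ENUMERATION, fcc**: under `‖G − 1‖ ≤ 1/4`, for a kernel `W` vanishing from `R` on and a box size `K` with `8R² < 3(K+1)²`,
the lattice sum over `G·L_fcc ∖ 0` IS the finite sum over the labels `b ∈ [−K, K]³ ∖ 0`. [folklore] -/
theorem latticeSum_fcc_eq_boxSum {G : E3 →L[ℝ] E3} (hG : ‖G - 1‖ ≤ 1 / 4) {W : ℝ → ℝ} {R : ℝ} (hW : ∀ r : ℝ, R ≤ r → W r = 0)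
    {K : ℕ} (hK : 8 * R ^ 2 < 3 * ((K : ℝ) + 1) ^ 2) :
    ∑ᶠ v ∈ {v : E3 | v ≠ 0 ∧ ∃ b : Fin 3 → ℤ, v = latPt G fccVec b}, W ‖v‖ =
      ∑ b ∈ (Fintype.piFinset fun _ : Fin 3 => Finset.Icc (-(K : ℤ)) K).filter (fun b => b ≠ 0), W ‖latPt G fccVec b‖ := by
  have hinj := latPt_fcc_injective hG
  have hset : {v : E3 | v ≠ 0 ∧ ∃ b : Fin 3 → ℤ, v = latPt G fccVec b} = (latPt G fccVec) '' {b : Fin 3 → ℤ | b ≠ 0} := by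
    ext v
    constructor
    · rintro ⟨hv, b, rfl⟩
      exact ⟨b, fun hb => hv (by rw [hb, latPt_zero]), rfl⟩
    · rintro ⟨b, hb, rfl⟩
      exact ⟨fun h => hb (hinj (by rw [h, latPt_zero])), b, rfl⟩
  rw [hset, finsum_mem_image hinj.injOn,
    finsum_mem_inter_support_eq' (fun b : Fin 3 → ℤ => W ‖latPt G fccVec b‖) {b : Fin 3 → ℤ | b ≠ 0}
      (↑((Fintype.piFinset fun _ : Fin 3 => Finset.Icc (-(K : ℤ)) K).filter (fun b => b ≠ 0))) ?_]
  · exact finsum_mem_coe_finset _ _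
  · intro b hb
    have hlt : ‖latPt G fccVec b‖ < R := lt_of_not_ge fun h => hb (hW _ h)
    have hfp : ‖fccPoint b‖ < 4 / 3 * R := by
      have h34 := norm_apply_ge_of_near_one hG (fccPoint b)
      rw [← latPt_fccVec_eq] at h34
      linarith
    simp only [Finset.coe_filter, Set.mem_setOf_eq, mem_box_of_norm_fccPoint_lt hK hfp, true_and]

/-- ★★ **Record instance** (`W₄₅ = effPot w₄₅ ω₄ (3/400)` vanishes from `9/2` on; `8·(9/2)² = 162 < 192 = 3·8²` ⟹ `K = 7`):
`∑ᶠ v ∈ G·L_fcc ∖ 0, W₄₅ ‖v‖ = Σ_{b ∈ [−7,7]³ ∖ 0} W₄₅ ‖latPt G fccVec b‖` (`3374` labels). [folklore] -/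
theorem latticeSum_fcc_eq_boxSum_record {G : E3 →L[ℝ] E3} (hG : ‖G - 1‖ ≤ 1 / 4) :
    ∑ᶠ v ∈ {v : E3 | v ≠ 0 ∧ ∃ b : Fin 3 → ℤ, v = latPt G fccVec b}, effPot w₄₅ ω₄ (3 / 400) ‖v‖ =
      ∑ b ∈ (Fintype.piFinset fun _ : Fin 3 => Finset.Icc (-7 : ℤ) 7).filter (fun b => b ≠ 0),
        effPot w₄₅ ω₄ (3 / 400) ‖latPt G fccVec b‖ := by
  have h := latticeSum_fcc_eq_boxSum hG (W := effPot w₄₅ ω₄ (3 / 400)) (R := 9 / 2) (fun r hr => effPot_fourHalf_eq_zero _ hr)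
    (K := 7) (by norm_num)
  simpa using h

/-! ## §4. The fcc hypothesis of `homFloor_of_latticeSums` in box form -/

/-- ★ `HomFloor m` from the fcc BOX-SUM inequality (`[−7,7]³ ∖ 0`) and the hcp lattice-sum inequality (enumerated in the sequel). [folklore] -/
theorem homFloor_of_boxSum_fcc_of_latticeSum_hcp {m : ℝ}
    (hfcc : ∀ G : E3 →L[ℝ] E3, ‖G - 1‖ ≤ 1 / 4 →
      m ≤ (∑ b ∈ (Fintype.piFinset fun _ : Fin 3 => Finset.Icc (-7 : ℤ) 7).filter (fun b => b ≠ 0),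
        effPot w₄₅ ω₄ (3 / 400) ‖latPt G fccVec b‖) / 2 - (-(7175 / 10000) + 3 / 400))
    (hhcp : ∀ (G : E3 →L[ℝ] E3) (ξ : E3), ‖G - 1‖ ≤ 1 / 4 → ‖ξ‖ ≤ 1 / 4 →
      m ≤ (∑ᶠ v ∈ {v : E3 | v ≠ 0 ∧ ∃ b : Fin 3 → ℤ, v = latPt G hexFrame b ∨ v = latPt G hexFrame b + G (hcpShift + ξ)},
        effPot w₄₅ ω₄ (3 / 400) ‖v‖) / 2 - (-(7175 / 10000) + 3 / 400)) :
    HomFloor m :=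
  homFloor_of_latticeSums (fun G hG => by rw [latticeSum_fcc_eq_boxSum_record hG]; exact hfcc G hG) hhcp

end Summit.AtomisticToContinuum.Crystallization.Theorems.FrustratedLawDichotomyStrainedPatchHomLatticeBox

end
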